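import Summits.Ventures.HSemireg.CocycleExtensionMap
import Mathlib.Algebra.Homology.HomologicalComplexAbelian
import HarnessLib

/-!
# Venture HSemireg — cocycle extensions of COCHAIN COMPLEXES of `𝒪_X`-modules (gs-g4 gen 21, brick C4b of
# `general-structure/COMPLEX-LEIBNIZ-PLAN-gs-g4.md`)

HONEST FRAMING. Sheaf algebra on an arbitrary scheme `X` with a unit `1`-cocycle `c` (only its cover is used): the
termwise version of `CocycleExtension.ext` (files `CocycleExtension*.lean`). Nothing about any variety; nothing here
says HC, HC_CM or HC_AV is proved.

## Contents (everything proved)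

* `hom_ext_of_cover` — two morphisms of `𝒪_X`-modules agreeing over every `U_x` are equal.
* `LocalOneCocycleC c A B` — a local `1`-cocycle of cochain complexes: degreewise cocycles `w i` (`A.X i → B.X i`
  locally) commuting with the differentials; `precomp`, the zero cocycle.
* **`extC w : CochainComplex X.Modules ℤ`** — termwise `ext (w i)`, differential `CocycleExtension.map d_A d_B`;
  `ιC : B ⟶ extC w`, `πC : extC w ⟶ A`, **`shortExactC`** (`0 → B → extC w → A → 0` is a short exact sequence of
  complexes, degreewise `CocycleExtension.shortExact`); `mapC` (functoriality in `(A, B, w)`); for the zero cocycle the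
  retraction `ρC : extC 0 ⟶ B` with `ιC_ρC : ιC ≫ ρC = 𝟙`.

## References

* [Har77] R. Hartshorne, *Algebraic Geometry*, GTM 52 (1977), II Ex. 1.22, III.4.
-/

noncomputable section

set_option backward.isDefEq.respectTransparency false

open CategoryTheory CategoryTheory.Limits AlgebraicGeometry TopologicalSpace Opposite

namespace Summit.Ventures.HSemireg

open Literature.AlgebraicGeometry.Modules Literature.AlgebraicGeometry.HodgeTheory CocycleTwist

universe u

variable {X : Scheme.{u}} {c : UnitCocycle X}

/-- **Morphisms of `𝒪_X`-modules agreeing over every open `U_x` of the cover of `c` are equal** (sheaf locality).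
[folklore] -/
theorem hom_ext_of_cover (c : UnitCocycle X) {M N : X.Modules} {φ ψ : M ⟶ N}
    (h : ∀ x : X, (SheafOfModules.overFunctor _ (c.U x)).map φ = (SheafOfModules.overFunctor _ (c.U x)).map ψ) :
    φ = ψ := by
  refine Scheme.Modules.hom_ext _ _ fun V => AddCommGrpCat.ext fun s => ?_
  change φ.app V s = ψ.app V s
  have hcov : V ≤ ⨆ x : X, V ⊓ c.U x := fun v hv => Opens.mem_iSup.mpr ⟨v, ⟨hv, c.mem v⟩⟩
  refine TopCat.Sheaf.eq_of_locally_eq' (⟨N.presheaf, Scheme.Modules.isSheaf N⟩ : TopCat.Sheaf Ab X)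
    (fun x : X => V ⊓ c.U x) V (fun x => homOfLE inf_le_left) hcov _ _ fun x => ?_
  change N.presheaf.map _ (φ.app V s) = N.presheaf.map _ (ψ.app V s)
  rw [app_map_apply, app_map_apply, ← appLE_over_map (U := c.U x) φ (homOfLE inf_le_right),
    ← appLE_over_map (U := c.U x) ψ (homOfLE inf_le_right), h x]

variable (c) (A B A' B' : CochainComplex X.Modules ℤ)

/-- **A local `1`-cocycle of cochain complexes** `A → B` (locally, along the cover of `c`): degreewise local
`1`-cocycles `w i : A^i|_V → B^i|_V` commuting with the differentials. [cite: Hartshorne1977, III.4] -/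
structure LocalOneCocycleC where
  /-- the degreewise cocycles -/
  w : ∀ i : ℤ, LocalOneCocycle c (A.X i) (B.X i)
  /-- compatibility with the differentials: `d_A| ≫ w^j_{xy} = w^i_{xy} ≫ d_B|` -/
  comm : ∀ (i j : ℤ) (x y : X) (V : X.Opens) (hx : V ≤ c.U x) (hy : V ≤ c.U y),
    (SheafOfModules.overFunctor _ V).map (A.d i j) ≫ (w j).w x y V hx hy =
      (w i).w x y V hx hy ≫ (SheafOfModules.overFunctor _ V).map (B.d i j)

namespace LocalOneCocycleC

variable {c A B A' B'}

/-- Constructor checking the compatibility with `d` only in consecutive degrees. [folklore] -/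
def mk' (w : ∀ i : ℤ, LocalOneCocycle c (A.X i) (B.X i))
    (comm : ∀ (i : ℤ) (x y : X) (V : X.Opens) (hx : V ≤ c.U x) (hy : V ≤ c.U y),
      (SheafOfModules.overFunctor _ V).map (A.d i (i + 1)) ≫ (w (i + 1)).w x y V hx hy =
        (w i).w x y V hx hy ≫ (SheafOfModules.overFunctor _ V).map (B.d i (i + 1))) :
    LocalOneCocycleC c A B where
  w := w
  comm i j x y V hx hy := by
    by_cases hij : i + 1 = j
    · subst hij
      exact comm i x y V hx hy
    · rw [A.shape i j hij, B.shape i j hij]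
      exact CocycleExtension.compat_zero (w i) (w j) x y V hx hy

variable (w : LocalOneCocycleC c A B)

/-- **Pull-back along a chain map `f : A′ → A`.** [folklore] -/
def precomp (f : A' ⟶ A) : LocalOneCocycleC c A' B where
  w i := (w.w i).precomp (f.f i)
  comm i j x y V hx hy := by
    rw [LocalOneCocycle.precomp_w, LocalOneCocycle.precomp_w, ← Category.assoc, ← Functor.map_comp, ← f.comm i j,
      Functor.map_comp, Category.assoc, w.comm, Category.assoc]

/-- Components of the pull-back. [folklore] -/
@[simp]
theorem precomp_w (f : A' ⟶ A) (i : ℤ) : (w.precomp f).w i = (w.w i).precomp (f.f i) := rfl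

variable (c A B) in
/-- The zero cocycle of complexes. [folklore] -/
def zero : LocalOneCocycleC c A B where
  w _ := 0
  comm i j x y V hx hy := by rw [LocalOneCocycle.zero_w, LocalOneCocycle.zero_w, zero_comp, Limits.comp_zero]

/-- `0` is the zero cocycle of complexes. [folklore] -/
instance : Zero (LocalOneCocycleC c A B) := ⟨zero c A B⟩

/-- Components of the zero cocycle of complexes. [folklore] -/
@[simp]
theorem zero_w' (i : ℤ) : (0 : LocalOneCocycleC c A B).w i = 0 := rfl

end LocalOneCocycleC

namespace CocycleExtension

variable {c A B A' B'} (w : LocalOneCocycleC c A B) (w' : LocalOneCocycleC c A' B')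

/-- **The cocycle extension of cochain complexes** `extC w`: termwise `ext (w i)`, differential
`map d_A d_B`. [cite: Hartshorne1977, II Ex. 1.22] -/
def extC : CochainComplex X.Modules ℤ where
  X i := ext (w.w i)
  d i j := map (w.w i) (w.w j) (A.d i j) (B.d i j) (w.comm i j)
  shape i j hij := map_eq_zero _ _ (A.shape i j hij) (B.shape i j hij) _
  d_comp_d' i j k _ _ := by
    rw [map_comp _ _ _ _ _ _ _ (w.comm i j) (w.comm j k) (compat_comp _ _ _ (w.comm i j) (w.comm j k))]
    exact map_eq_zero _ _ (A.d_comp_d i j k) (B.d_comp_d i j k) _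

/-- The terms of `extC w`. [folklore] -/
theorem extC_X (i : ℤ) : (extC w).X i = ext (w.w i) := rfl

/-- The differential of `extC w`. [folklore] -/
theorem extC_d (i j : ℤ) : (extC w).d i j = map (w.w i) (w.w j) (A.d i j) (B.d i j) (w.comm i j) := rfl

/-- **`ιC : B ⟶ extC w`**, termwise `ι`. [folklore] -/
def ιC : B ⟶ extC w where
  f i := ι (w.w i)
  comm' i j _ := by rw [extC_d, ι_map]

/-- **`πC : extC w ⟶ A`**, termwise `π`. [folklore] -/
def πC : extC w ⟶ A where
  f i := π (w.w i)
  comm' i j _ := by rw [extC_d, map_π]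

/-- Components of `ιC`. [folklore] -/
@[simp] theorem ιC_f (i : ℤ) : (ιC w).f i = ι (w.w i) := rfl

/-- Components of `πC`. [folklore] -/
@[simp] theorem πC_f (i : ℤ) : (πC w).f i = π (w.w i) := rfl

/-- `ιC ≫ πC = 0`. [folklore] -/
theorem ιC_πC : ιC w ≫ πC w = 0 := by
  refine HomologicalComplex.hom_ext _ _ fun i => ?_
  rw [HomologicalComplex.comp_f, ιC_f, πC_f, ι_comp_π, HomologicalComplex.zero_f]

/-- The short complex `B → extC w → A`. [folklore] -/
abbrev shortComplexC : ShortComplex (CochainComplex X.Modules ℤ) := ShortComplex.mk (ιC w) (πC w) (ιC_πC w)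

/-- **`0 → B → extC w → A → 0` is a short exact sequence of complexes** (degreewise `CocycleExtension.shortExact`).
[cite: Hartshorne1977, II Ex. 1.22] -/
theorem shortExactC : (shortComplexC w).ShortExact :=
  HomologicalComplex.shortExact_of_degreewise_shortExact _ fun i => shortExact (w.w i)

section MapC

variable (f : A ⟶ A') (g : B ⟶ B')
  (h : ∀ (i : ℤ) (x y : X) (V : X.Opens) (hx : V ≤ c.U x) (hy : V ≤ c.U y),
    (SheafOfModules.overFunctor _ V).map (f.f i) ≫ (w'.w i).w x y V hx hy =
      (w.w i).w x y V hx hy ≫ (SheafOfModules.overFunctor _ V).map (g.f i))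

/-- **Functoriality of `extC`** in `(A, B, w)`: termwise `map (f^i, g^i)`. [folklore] -/
def mapC : extC w ⟶ extC w' where
  f i := map (w.w i) (w'.w i) (f.f i) (g.f i) (h i)
  comm' i j _ := by
    rw [extC_d, extC_d, map_comp _ _ _ _ _ _ _ (h i) (w'.comm i j) (compat_comp _ _ _ (h i) (w'.comm i j)),
      map_comp _ _ _ _ _ _ _ (w.comm i j) (h j) (compat_comp _ _ _ (w.comm i j) (h j))]
    exact map_congr _ _ (f.comm i j) (g.comm i j) _ _

/-- Components of `mapC`. [folklore] -/
@[simp]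
theorem mapC_f (i : ℤ) : (mapC w w' f g h).f i = map (w.w i) (w'.w i) (f.f i) (g.f i) (h i) := rfl

/-- `ιC ≫ mapC = g ≫ ιC′`. [folklore] -/
theorem ιC_mapC : ιC w ≫ mapC w w' f g h = g ≫ ιC w' := by
  refine HomologicalComplex.hom_ext _ _ fun i => ?_
  rw [HomologicalComplex.comp_f, HomologicalComplex.comp_f, ιC_f, mapC_f, ιC_f, ι_map]

/-- `mapC ≫ πC′ = πC ≫ f`. [folklore] -/
theorem mapC_πC : mapC w w' f g h ≫ πC w' = πC w ≫ f := by
  refine HomologicalComplex.hom_ext _ _ fun i => ?_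
  rw [HomologicalComplex.comp_f, HomologicalComplex.comp_f, πC_f, mapC_f, πC_f, map_π]

end MapC

/-! ### The zero cocycle: the retraction `ρC` -/

section ZeroC

variable (c A B)

/-- **The retraction `ρC : extC 0 ⟶ B`** of the split extension along the zero cocycle (termwise `ρ`; a chain map
because the local retractions commute with `map` — checked over the cover). [folklore] -/
def ρC : extC (0 : LocalOneCocycleC c A B) ⟶ B where
  f i := ρ (A.X i) (B.X i)
  comm' i j _ := by
    refine hom_ext_of_cover c fun x => ?_
    rw [Functor.map_comp, Functor.map_comp, restrictHom_ρ, restrictHom_ρ, extC_d]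
    exact (map_ret _ _ _ _ _ x).symm

/-- Components of `ρC`. [folklore] -/
@[simp] theorem ρC_f (i : ℤ) : (ρC c A B).f i = ρ (c := c) (A.X i) (B.X i) := rfl

/-- **`ιC ≫ ρC = 𝟙`.** [folklore] -/
theorem ιC_ρC : ιC (0 : LocalOneCocycleC c A B) ≫ ρC c A B = 𝟙 B := by
  refine HomologicalComplex.hom_ext _ _ fun i => ?_
  rw [HomologicalComplex.comp_f, ιC_f, ρC_f, HomologicalComplex.id_f]
  exact ι_ρ (A.X i) (B.X i)

end ZeroC

end CocycleExtension

end Summit.Ventures.HSemireg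

end
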